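import Summits.CriticalPhenomena.CardyFormulaZ2.Theses.CardyObliqueExplorer

/-!
# Birth skeleton (BC3) for the crux `ExplorationHitCardy` — stmt-CriticalPhenomena-11249

Route `CardyObliqueExplorer` (route-CriticalPhenomena-CardyObliqueExplorer), sub-problem
`CardyFormulaZ2`, summit `CriticalPhenomena`. Registrar: planner `skel-stmt-CriticalPhenomena-11249`
(2026-08-17; BC3 of `run/shared/lean/lens3/_common/BC.md`; mode skeleton-register, re-audit bin
REPAIRABLE).

The crux (route decl, FIXED — `Summit.CriticalPhenomena.CardyFormulaZ2.Theses.CardyObliqueExplorer.ExplorationHitCardy`):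
for every conformal rectangle `R = (Ω; a, b, c, d)` and every admissible square-lattice discretising
family `E` of its chord `(Ω; a, c)` (hypothesis block HB: `(E δ).Ω = Ω`, mesh `δ`, wired / dual-wired
arcs → `(abc)`, `(cda)` in Hausdorff distance, discrete marks → `{a, c}`, `IsZdAdmissible` eventually),
the `P_{1/2}`-probability that the `a → c`-oriented medial exploration of critical bond percolation in
`E δ` examines an edge with an endpoint on `(cd)_δ` before any edge with an endpoint on `(bc)_δ` has
crossing limit `cardyFunction` (→ `F(η)` for every uniformizing datum).

## The line = the route's own mechanism (module docstring, TWO-LAYER PLAN: "first split to file: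
ExplorationHitCardy ⇐ DoobIdentity → ObliqueInvariance → TipBalance → ExplorationHitCardy")

Write `P δ` for the hitting probability above, `u₀ δ := obliqueMedialAbsorb R (E δ) ∅ [] (obliqueMedialCCell R (E δ))`
(absorption probability at the corner `b` of the OBLIQUELY REDIRECTED / KILLED medial random walk in
the fixed discrete domain, started from the `(cd)_δ`-cell nearest `c`; landed definition D1,
`Literature/Probability/LatticeModels/ObliqueMedialAbsorb.lean`) and `S δ := tipBalanceSum R (E δ)`
(the expected weighted tip-stencil sum along the exploration; landed definition D2,
`Literature/Probability/Percolation/TipBalanceSum.lean`). The three stubs, each stated VERBATIM as the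
route item it is (same HB, same conclusion; the wiring `example` at the end certifies the identity
definitionally):

* `stub_doobIdentity` = item stmt-CriticalPhenomena-7457 `DoobIdentity` (support, rank 9; size M/L):
  `HB → (P δ − u₀ δ − S δ / 2) → 0` as `δ → 0⁺` — the Doob (rank-one) update of the walk's absorption
  probability when the exploration reveals one cell, summed along the exploration and optionally
  stopped (Schramm–Sheffield 2005 §3.1 Lemma 1 is the harmonic-coin analogue). The EXACT identity
  `P − u₀ = S/2` at each admissible `δ` is the intended proof; the `o(1)` form absorbs the three
  kernel conventions listed in the route header (re-filtered interior neighbours, resolution-fuel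
  leak to ⊥, unrevealed deciding cell). Why it might fail: those leaks are not `o(1)`.
* `stub_obliqueInvariance` = item stmt-CriticalPhenomena-7456 `ObliqueInvariance` (crux, rank 3;
  size XL; HARDEST): `HB → R.HasCrossingLimit u₀ cardyFunction` — invariance principle "obliquely
  redirected / killed medial walk → Brownian motion obliquely reflected at angle π/3 on `(ab) ∪ (bd)`,
  killed on `(da)`" in a Jordan domain (Varadhan–Williams 1985, Kang–Williams 2007, Dubedat 2004)
  plus the gambler's-ruin identification of the ORBM absorption probability with Cardy–Carleson's
  `F(η)` (`CarlesonAtOpenCorner`, provable now). Why it might fail (refuter note on the item): the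
  slope-blind D1 redirection rule has a slope-dependent effective reflection angle on lattice
  staircases, so off rectilinear carriers the limit may solve the wrong mixed problem.
* `stub_tipBalance` = item stmt-CriticalPhenomena-7451 `TipBalance` (crux, rank 2; size L/XL):
  `HB → S δ → 0` — the fair coin of percolation against the oblique coin of the walk, balanced at the
  tip: the weighted stencil sum `E Σ_n w_n(c_δ)(c_n − 2u_n)(f_n)` vanishes in the limit
  (tip-environment symmetry + singular-mode expansion at a slit tip + weight budget). Why it might
  fail: a non-decaying per-step bias of the stencil (the kakutani-fingerprint verdict transplanted),
  or `Σ_n w_n(c_δ)` outgrowing the stencil decay.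

Composition `ExplorationHitCardy_of : DoobIdentity → ObliqueInvariance → TipBalance → ExplorationHitCardy`
(the type of the route's support item stmt-CriticalPhenomena-14495 `ExplorationHitGlue`, concluded BY
NAME; real proof, pure filter algebra: `(P − u₀ − S/2) + u₀ + S/2 = P`, limits `0 + F(η) + 0/2`).
No stub is cheaply the crux or the conjunct: each of the three misses one of the other two limits
(BC3 probes, planner folder `bc/stub_<name>_probe.lean`, all FAIL — see `Lines/birth.md`).
`KernelDominance` (stmt-7448, rank 6) is deliberately NOT a stub: it serves the companion oblique
harmonic explorer / the sign structure of the stencil, not the identity, and is not load-bearing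
for X.

Disproof used: none on file (`ledger crux ls stmt-CriticalPhenomena-11249`: no workfiles, no
`Disproof.lean`, 2026-08-17). Negatives index (`ledger negatives --problem CriticalPhenomena`, 11
entries, 2026-08-17): no stub is an instance of a refuted statement (none concerns the oblique walk,
the tip-balance sum or the lattice hitting event; stmt-0698 `not_SymmetryUpgrade` is about abstract
chordal families and is not assumed anywhere here).
-/

namespace Summit.CriticalPhenomena.CardyFormulaZ2.Cruxes.ExplorationHitCardy.Birth

open Summit.CriticalPhenomena.CardyFormulaZ2.Theses.CardyObliqueExplorer
  (DoobIdentity ObliqueInvariance TipBalance)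

/-! ### Registered stubs (the ONLY `sorry`s of this file; signatures = the route items verbatim) -/

/-- **S1 `stub_doobIdentity`** — the Doob identity in `o(1)` form (= route item
stmt-CriticalPhenomena-7457 `DoobIdentity`): along every admissible discretising family,
`P_{1/2}[exploration hits (cd)_δ before (bc)_δ] − u₀^δ(c_δ) − tipBalanceSum R (E δ) / 2 → 0`.
Finite Markov-chain algebra (rank-one updates at fresh cells, fair independent coins, decided
observable at the stopping step) + optional stopping. Size M/L. -/
theorem stub_doobIdentity :
    ∀ (R : Literature.Probability.RandomPlanarGeometry.ConformalRectangle) (E : ℝ →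
    Literature.Probability.LatticeModels.DiscreteDobrushin), (∀ δ, (E δ).Ω = R.carrier ∧ (E δ).δ =
    δ) → Filter.Tendsto (fun δ => Metric.hausdorffEDist (E δ).arcA ((R.chord 0 2 (by decide)).arc
    0)) (nhdsWithin 0 (Set.Ioi 0)) (nhds 0) → Filter.Tendsto (fun δ => Metric.hausdorffEDist (E
    δ).arcB ((R.chord 0 2 (by decide)).arc 1)) (nhdsWithin 0 (Set.Ioi 0)) (nhds 0) → Filter.Tendsto
    (fun δ => Metric.hausdorffEDist (Literature.Probability.LatticeModels.medialPoint δ '' (E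
    δ).zdABEdges) {R.pt 0, R.pt 2}) (nhdsWithin 0 (Set.Ioi 0)) (nhds 0) → (∀ᶠ δ in nhdsWithin (0:ℝ)
    (Set.Ioi 0), (E δ).IsZdAdmissible) → Filter.Tendsto (fun δ =>
    (Literature.Probability.Percolation.bondPercolation
    (Literature.Probability.LatticeModels.zdGraph 2) Literature.Probability.Percolation.half).real
    {cfg | let l := Literature.Probability.LatticeModels.medialExploration (E δ) cfg; let l' := (if
    (∀ e₀ ∈ l.head?, dist (Literature.Probability.LatticeModels.medialPoint δ e₀) (R.pt 0) ≤ dist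
    (Literature.Probability.LatticeModels.medialPoint δ e₀) (R.pt 2)) then l else l.reverse); ∃ n :
    ℕ, ∃ e ∈ l'[n]?, (∃ v ∈ e, v ∈ (E δ).zdDiscreteArc (R.arc 2)) ∧ ∀ m < n, ∀ e' ∈ l'[m]?, ∀ v ∈
    e', v ∉ (E δ).zdDiscreteArc (R.arc 1)} -
    Literature.Probability.LatticeModels.obliqueMedialAbsorb R (E δ) ∅ []
    (Literature.Probability.LatticeModels.obliqueMedialCCell R (E δ)) -
    Literature.Probability.Percolation.tipBalanceSum R (E δ) / 2) (nhdsWithin 0 (Set.Ioi 0)) (nhds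
    0) := by
  sorry

/-- **S2 `stub_obliqueInvariance`** — oblique invariance principle + Carleson value (= route item
stmt-CriticalPhenomena-7456 `ObliqueInvariance`, crux rank 3; the HARDEST stub): in the FIXED
discrete domain the absorption probability at `b` of the oblique medial walk started from the
`(cd)_δ`-cell nearest `c` has crossing limit `cardyFunction`. Size XL. -/
theorem stub_obliqueInvariance :
    ∀ (R : Literature.Probability.RandomPlanarGeometry.ConformalRectangle) (E : ℝ →
    Literature.Probability.LatticeModels.DiscreteDobrushin), (∀ δ, (E δ).Ω = R.carrier ∧ (E δ).δ =
    δ) → Filter.Tendsto (fun δ => Metric.hausdorffEDist (E δ).arcA ((R.chord 0 2 (by decide)).arc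
    0)) (nhdsWithin 0 (Set.Ioi 0)) (nhds 0) → Filter.Tendsto (fun δ => Metric.hausdorffEDist (E
    δ).arcB ((R.chord 0 2 (by decide)).arc 1)) (nhdsWithin 0 (Set.Ioi 0)) (nhds 0) → Filter.Tendsto
    (fun δ => Metric.hausdorffEDist (Literature.Probability.LatticeModels.medialPoint δ '' (E
    δ).zdABEdges) {R.pt 0, R.pt 2}) (nhdsWithin 0 (Set.Ioi 0)) (nhds 0) → (∀ᶠ δ in nhdsWithin (0:ℝ)
    (Set.Ioi 0), (E δ).IsZdAdmissible) → R.HasCrossingLimit (fun δ =>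
    Literature.Probability.LatticeModels.obliqueMedialAbsorb R (E δ) ∅ []
    (Literature.Probability.LatticeModels.obliqueMedialCCell R (E δ)))
    Literature.Probability.RandomPlanarGeometry.cardyFunction := by
  sorry

/-- **S3 `stub_tipBalance`** — tip balance (= route item stmt-CriticalPhenomena-7451 `TipBalance`,
crux rank 2): the expected weighted tip-stencil sum `tipBalanceSum R (E δ)` tends to `0` as
`δ → 0⁺` along every admissible discretising family. Size L/XL. -/
theorem stub_tipBalance :
    ∀ (R : Literature.Probability.RandomPlanarGeometry.ConformalRectangle) (E : ℝ →
    Literature.Probability.LatticeModels.DiscreteDobrushin), (∀ δ, (E δ).Ω = R.carrier ∧ (E δ).δ =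
    δ) → Filter.Tendsto (fun δ => Metric.hausdorffEDist (E δ).arcA ((R.chord 0 2 (by decide)).arc
    0)) (nhdsWithin 0 (Set.Ioi 0)) (nhds 0) → Filter.Tendsto (fun δ => Metric.hausdorffEDist (E
    δ).arcB ((R.chord 0 2 (by decide)).arc 1)) (nhdsWithin 0 (Set.Ioi 0)) (nhds 0) → Filter.Tendsto
    (fun δ => Metric.hausdorffEDist (Literature.Probability.LatticeModels.medialPoint δ '' (E
    δ).zdABEdges) {R.pt 0, R.pt 2}) (nhdsWithin 0 (Set.Ioi 0)) (nhds 0) → (∀ᶠ δ in nhdsWithin (0:ℝ)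
    (Set.Ioi 0), (E δ).IsZdAdmissible) → Filter.Tendsto (fun δ =>
    Literature.Probability.Percolation.tipBalanceSum R (E δ)) (nhdsWithin 0 (Set.Ioi 0)) (nhds 0) := by
  sorry

/-! ### The composition: the three stubs imply the crux, BY NAME (sorry-free) -/

/-- **`ExplorationHitCardy` from S1 + S2 + S3** (pure filter algebra, no percolation input): for a
conformal rectangle `R`, an admissible family `E` and a uniformizing datum `(φ, x)`, S1 gives
`P − u₀ − S/2 → 0`, S2 gives `u₀ → F(η)`, S3 gives `S → 0`; adding, `P = (P − u₀ − S/2) + u₀ + S/2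
→ 0 + F(η) + 0/2 = F(η)`. The hypotheses are the route's own items `DoobIdentity` (7457),
`ObliqueInvariance` (7456), `TipBalance` (7451) by name; the conclusion is the crux decl by name. -/
theorem ExplorationHitCardy_of :
    DoobIdentity → ObliqueInvariance → TipBalance →
      Summit.CriticalPhenomena.CardyFormulaZ2.Theses.CardyObliqueExplorer.ExplorationHitCardy := by
  intro hD hO hT R E hE hA hB hM hadm φ x hφx
  -- S1: the Doob identity in o(1) form
  have h₁ := hD R E hE hA hB hM hadm
  -- S2: the oblique observable converges to Cardy's value at this uniformizing datum
  have h₂ := hO R E hE hA hB hM hadm φ x hφx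
  -- S3: the tip-balance sum vanishes (hence so does its half)
  have h₃ := (hT R E hE hA hB hM hadm).div_const 2
  have h := (h₁.add h₂).add h₃
  rw [zero_add, zero_div, add_zero] at h
  refine h.congr' (Filter.Eventually.of_forall fun δ => ?_)
  ring

/-- Wiring check: the registered (sorried) stubs feed `ExplorationHitCardy_of` exactly as stated —
so the stub statements ARE the route items `DoobIdentity` / `ObliqueInvariance` / `TipBalance`
(definitionally). An `example`, so that `ExplorationHitCardy_of` stays the only theorem of this
file concluding the crux. -/
example : Summit.CriticalPhenomena.CardyFormulaZ2.Theses.CardyObliqueExplorer.ExplorationHitCardy :=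
  ExplorationHitCardy_of stub_doobIdentity stub_obliqueInvariance stub_tipBalance

end Summit.CriticalPhenomena.CardyFormulaZ2.Cruxes.ExplorationHitCardy.Birth
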